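import Summits.BirchSwinnertonDyer.BirchSwinnertonDyer.Theorems.KatoDescentPotSupersingularWildUpperDefectBillCount
import Summits.BirchSwinnertonDyer.BirchSwinnertonDyer.Theorems.KatoDescentPotSupersingularWildUpperOptimalSharpNodes
import HarnessLib

/-!
# Route `KatoDescentPotSupersingular` (rung K9, wild `3`, cell `bsd-potss`): the U₀ BILL of item
# stmt-BirchSwinnertonDyer-19197 `WildUpperDefectRankZero` over the OPTIMAL-MEMBER node — the two displayed JETCHEV READINGS
# (`q ≠ 3` Mult form, `q = 3` `JetchevBoundAtP`-type) and Coates–Sujatha's (A) on the RESIDUE classes only, in place of the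
# per-row anchor certificates of the count bill (p458646) — route-free `--supports` file; seat `bsd-potss-k8t-c4` g7
# (courtesy K9 twin of the KT bills p484978/p487746); nothing booked, BSD is not proved by any of this, the item is NOT closed

Composition: 19197 body ⟸ (irreducible, tower onto → A161″ `X4RankZero.missingUpperBoundAt_of_katoTam`) · (irreducible,
tower not onto → this seat's `WildUpperOptimalSharpNodes.wildUpperNonsurjTower_of_jetchevReadings_of_cruxAResidue`, p487595)
· (reducible → kmc's count node `ReducibleUpperOfCountInputs.missingUpperBoundAt_of_memberCountInputs`) — exactly the count
bill's dispatch (`WildUpperDefectBillCount.wildUpperDefectRankZero_bill_of_countInputs_of_anchors`) with the ♯-row anchors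
replaced by the readings `hJr`/`hJp` and the residue (A) `hCS`. Displayed schemas are NOT theorems of the tree and NOT
asserted (D-audit of the `q ≠ p` reading PASS, ref g28; the `q = p` step unprinted — GAP of record). Conditional
throughout; nothing asserted; no item is closed.

References: [Jetchev2008] Thm. 1.4, Cor. 1.5, Lemma 4.3, Rem. 6.2; [MatarNekovar2019] Thm. 0.3, §0.11; [Kato2004Asterisque]
Thm. 14.5 (3), (14.9.3), Prop. 14.16; [CoatesSujatha2005] Conj. A; [MilneADT2006] Thm. I.7.3; [BurungaleFlach2024] Cor. 2.
-/

set_option autoImplicit false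
-- sibling precedent (`KatoDescentPotSupersingularAssembly.lean`): the directory name repeats the summit name
set_option linter.dupNamespace false

noncomputable section

open scoped Classical

namespace Summit.BirchSwinnertonDyer.BirchSwinnertonDyer.Theorems.WildUpperDefectBillOptimal

open WeierstrassCurve Literature.NumberTheory.EllipticCurves
  Literature.NumberTheory.EllipticCurves.ModularForms
  Literature.NumberTheory.EllipticCurves.Rank1Residual
  Literature.NumberTheory.EllipticCurves.Rank1Residual.Typed
  Summit.BirchSwinnertonDyer.Rank1Residual
  Summit.BirchSwinnertonDyer.Rank1Residual.Additive
  Summit.BirchSwinnertonDyer.Rank1Residual.O6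
  Summit.BirchSwinnertonDyer.BirchSwinnertonDyer.Theorems

/-- **THE K9 U₀ BILL over the optimal-member node (item 19197 `WildUpperDefectRankZero`, conclusion = its BODY).** Granted the
Heegner-road published facts (`hGZ`, `hKo`, `hMN`, `hnf`, `hBFH`), Cassels (`hCassels`), Kato's `H¹_Iw` data and member count
(`hne`, `hin`), the K9 items `KatoTamagawaExactInputs` (`hK`), `PublishedInputsFineSelmerCM` (`hF`), L₀ (`h₂`), `WildRankOne` (`hR`),
the two DISPLAYED Jetchev readings (`hJr`: `q ≠ 3`, Mult form; `hJp`: `q = 3`) and Coates–Sujatha's (A) on the RESIDUE classes (`hCS`),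
the upper half holds on every rank-`0` O6 defect row. Conditional; nothing asserted; no item is closed.
[cite: Jetchev2008, Thm. 1.4, Cor. 1.5 (p. 3), Lemma 4.3 (p. 9), Rem. 6.2 (p. 15)] [cite: Kato2004Asterisque, Thm. 14.5 (3) (p. 236), Prop. 14.16 (pp. 244–245)]
[cite: CoatesSujatha2005, Conjecture A] [cite: MilneADT2006, Thm. I.7.3 and Remark I.7.4] -/
theorem wildUpperDefectRankZero_bill_of_jetchevReadings_of_cruxAResidue
    (hGZ : ∀ (N : ℕ) [NeZero N] (W : WeierstrassCurve ℚ) (K : Type) [Field K] [NumberField K],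
      gross_zagier N W K)
    (hKo : ∀ (N : ℕ) [NeZero N] (W : WeierstrassCurve ℚ) (K : Type) [Field K] [NumberField K],
      kolyvagin N W K)
    (hMN : ∀ (N : ℕ) [NeZero N] (W : WeierstrassCurve ℚ) (K : Type) [Field K] [NumberField K],
      MatarNekovar2019.thm03_padicValNat_card_sha_le_of_irreducible N W K)
    (hnf : exists_isNewformOf) (hBFH : bumpFriedbergHoffstein_exists_heegnerField_split_twist_simpleZero)
    (hK : Kato2004.rankZero_padicValNat_sha_add_padicValNat_tamagawa_le_of_additive_potGood_of_imageContainsSL2 ∧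
      rank_eq_analyticRank_of_analyticRank_le_one ∧ WeierstrassCurve.hasEntireLFunction_rat)
    (hF : Kato2004.rankZero_padicValNat_sha_add_padicValNat_tamagawa_le_of_additive_potGood_of_irreducible_of_fineSelmerDual_fg ∧
      bsdTriple_of_hasCM_of_L_one_ne_zero)
    (hCassels : bsdRHS_eq_of_isIsogenous)
    (hne : Kato2004.nonempty_iwasawaH1Data) (hin : Kato2004.exists_memberHullCountInputs)
    (h₂ : ∀ (W : WeierstrassCurve ℚ) [W.IsElliptic] [W.IsGloballyMinimal] [Fact (3 : ℕ).Prime],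
      W.analyticRank = 0 → ClassO6 W 3 → MissingLowerBoundAt W 3)
    (hR : ∀ (W : WeierstrassCurve ℚ) [W.IsElliptic] [W.IsGloballyMinimal] [Fact (3 : ℕ).Prime],
      W.analyticRank = 1 → ClassO6 W 3 → MissingPPartAt W 3)
    (hJr : ∀ (N : ℕ) [NeZero N] (W : WeierstrassCurve ℚ) [W.IsElliptic] [W.IsGloballyMinimal]
      (K : Type) [Field K] [NumberField K],
      IsImaginaryQuadratic K → NumberField.discr K ≠ -3 → SatisfiesHeegnerHypothesis N K →
      ∀ (p : ℕ) [Fact p.Prime], p ≠ 2 → W.analyticRank = 0 → Addv W p → 0 ≤ padicValRat p W.j →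
      ¬ W.HasCM → W.HasIrreducibleModPGaloisRep p → ¬ (∀ n : ℕ, W.HasSurjectiveModNGaloisRep (p ^ n : ℕ)) →
      (∃ Dt : ModularParametrizationData W N,
        (∀ z ∈ Dt.L.lattice, ∃ w ∈ periodLattice Dt.f, z = (Dt.c : ℂ) * w) ∧ ¬ (p : ℤ) ∣ Dt.c) →
      ¬ p ∣ (W.baseChange ℚ_[p]).localTamagawaNumber ℤ_[p] →
      ∀ {P : (W.baseChange K).toAffine.Point}, IsHeegnerPoint N W K P → ¬ IsOfFinAddOrder P →
      ∀ (q : ℕ) [Fact q.Prime], q ∣ N → ¬ q ^ 2 ∣ N → q ≠ p →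
      padicValNat p (Nat.card (AddCommGroup.primaryComponent (W.baseChange K).sha p)) +
          2 * padicValNat p ((W.baseChange ℚ_[q]).localTamagawaNumber ℤ_[q]) ≤
        2 * padicValNat p (AddSubgroup.zmultiples P).index)
    (hJp : ∀ (N : ℕ) [NeZero N] (W : WeierstrassCurve ℚ) [W.IsElliptic] [W.IsGloballyMinimal]
      (K : Type) [Field K] [NumberField K],
      IsImaginaryQuadratic K → NumberField.discr K ≠ -3 → SatisfiesHeegnerHypothesis N K →
      ∀ (p : ℕ) [Fact p.Prime], p ≠ 2 → W.analyticRank = 0 → Addv W p → 0 ≤ padicValRat p W.j →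
      ¬ W.HasCM → W.HasIrreducibleModPGaloisRep p → ¬ (∀ n : ℕ, W.HasSurjectiveModNGaloisRep (p ^ n : ℕ)) →
      (∃ Dt : ModularParametrizationData W N,
        (∀ z ∈ Dt.L.lattice, ∃ w ∈ periodLattice Dt.f, z = (Dt.c : ℂ) * w) ∧ ¬ (p : ℤ) ∣ Dt.c) →
      ∀ {P : (W.baseChange K).toAffine.Point}, IsHeegnerPoint N W K P → ¬ IsOfFinAddOrder P →
      p ∣ N →
      padicValNat p (Nat.card (AddCommGroup.primaryComponent (W.baseChange K).sha p)) +
          2 * padicValNat p ((W.baseChange ℚ_[p]).localTamagawaNumber ℤ_[p]) ≤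
        2 * padicValNat p (AddSubgroup.zmultiples P).index)
    (hCS : ∀ (W : WeierstrassCurve ℚ) [W.IsElliptic] [W.IsGloballyMinimal] [Fact (3 : ℕ).Prime],
      W.analyticRank = 0 → ClassO6 W 3 → W.HasIrreducibleModPGaloisRep 3 →
      ¬ (∀ n : ℕ, W.HasSurjectiveModNGaloisRep (3 ^ n : ℕ)) → ¬ W.HasCM →
      (∃ (W₀ : WeierstrassCurve ℚ) (_ : W₀.IsElliptic) (_ : W₀.IsGloballyMinimal)
          (_ : NeZero (W₀.conductorNorm ℤ)) (D₀ : ModularParametrizationData W₀ (W₀.conductorNorm ℤ)),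
        IsIsogenous W W₀ ∧ (∀ z ∈ D₀.L.lattice, ∃ w ∈ periodLattice D₀.f, z = (D₀.c : ℂ) * w) ∧
        ((3 : ℤ) ∣ D₀.c ∨ (3 ∣ W₀.tamagawaProduct ∧
          ¬ ∃ (q : ℕ) (_ : Fact q.Prime), q ∣ W₀.conductorNorm ℤ ∧
            (q ≠ 3 → ¬ q ^ 2 ∣ W₀.conductorNorm ℤ ∧ ¬ 3 ∣ (W₀.baseChange ℚ_[3]).localTamagawaNumber ℤ_[3]) ∧
            padicValNat 3 W₀.tamagawaProduct ≤
              padicValNat 3 ((W₀.baseChange ℚ_[q]).localTamagawaNumber ℤ_[q])))) →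
      ∀ (κ : ZpExtension ℚ 3), κ.IsCyclotomic →
        ∃ (γ : Field.absoluteGaloisGroup ℚ) (Df : W.FineSelmerDualData κ γ),
          Module.Finite ℤ_[3] (RestrictScalars ℤ_[3] (IwasawaAlgebra 3) Df.X)) :
    ∀ (W : WeierstrassCurve ℚ) [W.IsElliptic] [W.IsGloballyMinimal] [Fact (3 : ℕ).Prime],
      W.analyticRank = 0 → ClassO6 W 3 →
      ¬ (((∀ n : ℕ, W.HasSurjectiveModNGaloisRep (3 ^ n : ℕ)) ∧ ¬ 3 ∣ W.tamagawaProduct ∧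
            ∃ (N : ℕ) (_ : NeZero N) (D : ModularParametrizationData W N), ¬ (3 : ℤ) ∣ D.maninConstant) ∨
        (¬ W.HasIrreducibleModPGaloisRep 3 ∧
          (∀ (W' : WeierstrassCurve ℚ) [W'.IsElliptic], IsIsogenous W W' → ¬ 3 ^ 2 ∣ W'.torsionOrder) ∧
          ∀ q : ℚ, shaAn W = (q : ℂ) → Even (padicValRat 3 q))) →
      MissingUpperBoundAt W 3 := by
  intro W _ _ _ hr hO _hncov
  by_cases hirr : W.HasIrreducibleModPGaloisRep 3
  · by_cases hsurj : ∀ n : ℕ, W.HasSurjectiveModNGaloisRep (3 ^ n : ℕ)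
    · -- irreducible, tower onto: A161″ (Tamagawa-exact, Manin-free)
      exact X4RankZero.missingUpperBoundAt_of_katoTam (W := W) (p := 3) hK.1 hK.2.1 hK.2.2 hr
        ⟨hO.1, hO.2.1, hirr⟩ hO.padicValRat_j_nonneg hsurj
    · -- irreducible, tower not onto: the optimal-member node (readings on A/B rows, (A) on the residue)
      exact WildUpperOptimalSharpNodes.wildUpperNonsurjTower_of_jetchevReadings_of_cruxAResidue hJr hJp hGZ hKo hMN hnf
        hBFH hCassels hCS h₂ hR hK hF W hr hO hirr hsurj
  · -- reducible: the sharp count at Kato's member (kmc Part 16), every reducible row, no residue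
    exact ReducibleUpperOfCountInputs.missingUpperBoundAt_of_memberCountInputs hne hnf hin hCassels hK.2.1
      hK.2.2 W 3 hO.1 hO.2.1.1 hO.2.1.2 hO.padicValRat_j_nonneg hirr hr

end Summit.BirchSwinnertonDyer.BirchSwinnertonDyer.Theorems.WildUpperDefectBillOptimal

end
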